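import Literature.Computability.Cryptography.RegevSamplerGRLabel
import HarnessLib

/-!
# Regev 2009, Lemma 3.14 in machine form: the data-free `CNOT` layer (controlled load / controlled erase)

Topic `Computability/Cryptography` (family `pqc`), grouping namespace `Regev2009.SamplerRegs`; sequel of
`RegevSamplerGRLabel.lean` (`notLayer L`, the layer of `NOT`s erasing the Grover–Rudolph parameter word, and its
basis map `flipOn L`).

In the sampler's machine (`RegevSamplerMachine.machineCirc`) the parameter word of the Grover–Rudolph blocks is
uncomputed by `notLayer (eraseList …)` — a gate list that DEPENDS ON THE WORD, i.e. on the instance. A uniform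
circuit family indexed by the sizes alone cannot contain it. The standard remedy [Nielsen–Chuang 2010, §3.2.5;
Regev 2009, Lemma 3.14 (proof: "the classical part of the input is kept")] is to keep a classical copy of the word
on input wires that no stage modifies and to load / erase the parameter wires by `CNOT`s controlled on that copy:
the gate list then depends only on the wire positions.

This file provides that layer and its semantics:

* `cnotOp s t` — the total `CNOT` constructor (`RevOp.cnot` needs `s ≠ t`; off the diagonal it is `cnot`);
  `cnotLayer σ T := revCompile [cnotOp (σ t) t | t ∈ T]` — one `CNOT` onto every target `t ∈ T` from its source
  `σ t`; `xorOn σ T z` — its classical semantics `z[t ↦ z t ⊕ z (σ t)]_{t ∈ T}`.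
* `revEval_map_cnotOp` — for distinct targets none of which is a source, the layer computes `xorOn`
  (induction, as `Lemma24.revEval_map_not`); `isBasisMap_cnotLayer`; `cnotLayer_mem_unitaryGroup`.
* `xorOn_eq_flipOn` — **controlled load / erase at the label level**: on a label whose sources carry the word
  `c`, the layer flips exactly the targets `t` with `c t = true`, i.e. it is `flipOn (T.filter c)`.
* `cnotLayer_mulVec_eq_notLayer_mulVec` — **at the operator level**: on every state supported on labels whose
  sources carry `c`, `cnotLayer σ T` acts as `notLayer (T.filter c)`; `cnotLayer_mulVec_basisState`.
* `xorOn_apply_source`, `xorOn_apply_of_not_mem` — the sources and the idle wires are unchanged;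
  `cnotLayer_mulVec_supportedIn` — the layer preserves support on "the sources carry `c`".

Everything is proved (finite sums and an induction on the target list); no named fact is introduced.
HONEST FRAMING: kernel-checked lemmas of a KNOWN reduction (Regev 2009) — not summit progress.

## References

* O. Regev, *On lattices, learning with errors, random linear codes, and cryptography*, J. ACM 56 (2009),
  art. 34: Lemma 3.14 (proof) [Regev2009].
* M. A. Nielsen, I. L. Chuang, *Quantum Computation and Quantum Information*, CUP 2010, §3.2.5 (reversible
  classical computation, uncomputation by `CNOT` copies), §4.3 [NielsenChuang2010].
-/

noncomputable section

namespace Literature.Computability.Cryptography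

namespace Regev2009

namespace SamplerRegs

open Literature.Computability.QuantumComplexity Finset _root_.Matrix

variable {W : ℕ}

section CnotLayer

/-- The total `CNOT` constructor: `cnot s t` off the diagonal (and the harmless `not t` on it). [cite: NielsenChuang2010, §3.2.5] -/
def cnotOp (s t : Fin W) : RevOp W := if h : s = t then RevOp.not t else RevOp.cnot s t h

/-- Off the diagonal `cnotOp s t` XORs the source into the target. [cite: NielsenChuang2010, §3.2.5] -/
theorem cnotOp_eval {s t : Fin W} (h : s ≠ t) (z : QReg W) : (cnotOp s t).eval z = Function.update z t (z t ^^ z s) := by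
  unfold cnotOp
  rw [dif_neg h]
  rfl

/-- **The `CNOT` layer**: one `CNOT` onto every target `t ∈ T` from its source `σ t`, compiled into Clifford+T. Its gate
list depends only on the wire positions. [cite: NielsenChuang2010, §3.2.5] -/
def cnotLayer (σ : Fin W → Fin W) (T : List (Fin W)) : QCircuit cliffordT W := ⟨revCompile (T.map fun t => cnotOp (σ t) t)⟩

/-- The classical semantics of the layer: every target is XORed with its source. [cite: NielsenChuang2010, §3.2.5] -/
def xorOn (σ : Fin W → Fin W) (T : List (Fin W)) (z : QReg W) : QReg W := fun q => if q ∈ T then z q ^^ z (σ q) else z q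

/-- Idle wires are unchanged. [folklore] -/
theorem xorOn_apply_of_not_mem (σ : Fin W → Fin W) (T : List (Fin W)) (z : QReg W) {q : Fin W} (hq : q ∉ T) :
    xorOn σ T z q = z q := if_neg hq

/-- Sources (none of which is a target) are unchanged. [folklore] -/
theorem xorOn_apply_source (σ : Fin W → Fin W) (T : List (Fin W)) (hσ : ∀ t ∈ T, σ t ∉ T) (z : QReg W) {t : Fin W}
    (ht : t ∈ T) : xorOn σ T z (σ t) = z (σ t) := if_neg (hσ t ht)

/-- A target is XORed with its source. [folklore] -/
theorem xorOn_apply_of_mem (σ : Fin W → Fin W) (T : List (Fin W)) (z : QReg W) {q : Fin W} (hq : q ∈ T) :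
    xorOn σ T z q = (z q ^^ z (σ q)) := if_pos hq

/-- **For distinct targets none of which is a source, the `CNOT` layer computes `xorOn`.** [cite: NielsenChuang2010, §3.2.5] -/
theorem revEval_map_cnotOp (σ : Fin W → Fin W) : ∀ (T : List (Fin W)), T.Nodup → (∀ t ∈ T, σ t ∉ T) → ∀ (z : QReg W),
    revEval (T.map fun t => cnotOp (σ t) t) z = xorOn σ T z
  | [], _, _, z => by funext q; simp [revEval, xorOn]
  | a :: T, hT, hσ, z => by
    have ha : a ∉ T := (List.nodup_cons.1 hT).1
    have hσa : σ a ≠ a := fun h => hσ a List.mem_cons_self (by rw [h]; exact List.mem_cons_self)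
    have hσ' : ∀ t ∈ T, σ t ∉ T := fun t ht h => hσ t (List.mem_cons_of_mem a ht) (List.mem_cons_of_mem a h)
    rw [List.map_cons, revEval, cnotOp_eval hσa, revEval_map_cnotOp σ T (List.nodup_cons.1 hT).2 hσ']
    funext q
    simp only [xorOn, List.mem_cons, Function.update_apply]
    by_cases hqa : q = a
    · subst hqa
      rw [if_neg ha, if_pos rfl, if_pos (Or.inl rfl)]
    · by_cases hqT : q ∈ T
      · have hσq : σ q ≠ a := fun h => hσ q (List.mem_cons_of_mem a hqT) (by rw [h]; exact List.mem_cons_self)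
        rw [if_pos hqT, if_neg hqa, if_neg hσq, if_pos (Or.inr hqT)]
      · rw [if_neg hqT, if_neg hqa, if_neg (not_or.2 ⟨hqa, hqT⟩)]

/-- The `CNOT` layer (distinct targets, no target a source) is the basis map `xorOn σ T`. [cite: NielsenChuang2010, §3.2.5] -/
theorem isBasisMap_cnotLayer (A : Language Bool) (σ : Fin W → Fin W) (T : List (Fin W)) (hT : T.Nodup)
    (hσ : ∀ t ∈ T, σ t ∉ T) : IsBasisMap ((cnotLayer σ T).toMatrix A) (xorOn σ T) := fun z => by
  unfold cnotLayer
  rw [revCompile_mulVec_basisState, revEval_map_cnotOp σ T hT hσ]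

/-- The `CNOT` layer is unitary. [folklore] -/
theorem cnotLayer_mem_unitaryGroup (A : Language Bool) (σ : Fin W → Fin W) (T : List (Fin W)) :
    (cnotLayer σ T).toMatrix A ∈ Matrix.unitaryGroup (QReg W) ℂ :=
  QCircuit.toMatrix_mem_unitaryGroup_holds cliffordT_isUnitary_holds A _

/-- **Controlled load / erase, label level**: on a label whose sources carry the word `c`, the layer flips exactly the
targets `t` with `c t = true`. [cite: Regev2009, Lemma 3.14 (proof)] [cite: NielsenChuang2010, §3.2.5] -/
theorem xorOn_eq_flipOn (σ : Fin W → Fin W) (T : List (Fin W)) (c : Fin W → Bool) (z : QReg W)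
    (hz : ∀ t ∈ T, z (σ t) = c t) : xorOn σ T z = flipOn (T.filter fun t => c t) z := by
  funext q
  unfold xorOn flipOn
  by_cases hq : q ∈ T
  · rw [if_pos hq, hz q hq]
    by_cases hc : c q = true
    · rw [hc, if_pos (List.mem_filter.2 ⟨hq, hc⟩), Bool.xor_true]
    · rw [Bool.not_eq_true] at hc
      rw [hc, if_neg (fun h => by have := (List.mem_filter.1 h).2; rw [hc] at this; exact Bool.false_ne_true this),
        Bool.xor_false]
  · rw [if_neg hq, if_neg (fun h => hq (List.mem_filter.1 h).1)]

/-- **Controlled load / erase, operator level**: on every state supported on labels whose sources carry `c`, the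
data-free `CNOT` layer acts as the word-dependent `NOT` layer `notLayer (T.filter c)`.
[cite: Regev2009, Lemma 3.14 (proof)] [cite: NielsenChuang2010, §3.2.5] -/
theorem cnotLayer_mulVec_eq_notLayer_mulVec (A : Language Bool) (σ : Fin W → Fin W) (T : List (Fin W)) (hT : T.Nodup)
    (hσ : ∀ t ∈ T, σ t ∉ T) (c : Fin W → Bool) {ψ : QReg W → ℂ} (hψ : ∀ z, ψ z ≠ 0 → ∀ t ∈ T, z (σ t) = c t) :
    (cnotLayer σ T).toMatrix A *ᵥ ψ = (notLayer (T.filter fun t => c t)).toMatrix A *ᵥ ψ := by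
  rw [(isBasisMap_cnotLayer A σ T hT hσ).mulVec_eq_sum, (isBasisMap_notLayer A _ (hT.filter _)).mulVec_eq_sum]
  refine sum_congr rfl fun z _ => ?_
  by_cases hz : ψ z = 0
  · rw [hz, zero_smul, zero_smul]
  · rw [xorOn_eq_flipOn σ T c z (hψ z hz)]

/-- The layer on a basis state: the targets whose source bit is set are flipped. [cite: NielsenChuang2010, §3.2.5] -/
theorem cnotLayer_mulVec_basisState (A : Language Bool) (σ : Fin W → Fin W) (T : List (Fin W)) (hT : T.Nodup)
    (hσ : ∀ t ∈ T, σ t ∉ T) (z : QReg W) :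
    (cnotLayer σ T).toMatrix A *ᵥ basisState z = basisState (flipOn (T.filter fun t => z (σ t)) z) := by
  rw [isBasisMap_cnotLayer A σ T hT hσ z, xorOn_eq_flipOn σ T (fun t => z (σ t)) z fun _ _ => rfl]

/-- The layer preserves support on "the sources carry `c`" (the sources are idle). [folklore] -/
theorem cnotLayer_mulVec_supportedIn (A : Language Bool) (σ : Fin W → Fin W) (T : List (Fin W)) (hT : T.Nodup)
    (hσ : ∀ t ∈ T, σ t ∉ T) (c : Fin W → Bool) {ψ : QReg W → ℂ}
    (hψ : ∀ z, z ∉ {z : QReg W | ∀ t ∈ T, z (σ t) = c t} → ψ z = 0) :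
    ∀ z, z ∉ {z : QReg W | ∀ t ∈ T, z (σ t) = c t} → ((cnotLayer σ T).toMatrix A *ᵥ ψ) z = 0 := by
  intro x hx
  rw [(isBasisMap_cnotLayer A σ T hT hσ).mulVec_eq_sum ψ, Finset.sum_apply]
  refine sum_eq_zero fun z _ => ?_
  rw [Pi.smul_apply, basisState_apply, smul_eq_mul]
  by_cases hz : z ∈ {z : QReg W | ∀ t ∈ T, z (σ t) = c t}
  · rw [if_neg, mul_zero]
    rintro rfl
    exact hx fun t ht => by rw [Set.mem_setOf_eq] at hz; rw [xorOn_apply_source σ T hσ z ht]; exact hz t ht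
  · rw [hψ z hz, zero_mul]

/-- **Load then erase is the identity on the parameter wires**: applying the layer twice restores the label
(`xorOn` is an involution when no target is a source). [cite: NielsenChuang2010, §3.2.5] -/
theorem xorOn_xorOn (σ : Fin W → Fin W) (T : List (Fin W)) (hσ : ∀ t ∈ T, σ t ∉ T) (z : QReg W) :
    xorOn σ T (xorOn σ T z) = z := by
  funext q
  by_cases hq : q ∈ T
  · rw [xorOn_apply_of_mem σ T _ hq, xorOn_apply_of_mem σ T _ hq, xorOn_apply_source σ T hσ z hq, Bool.xor_assoc,
      Bool.xor_self, Bool.xor_false]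
  · rw [xorOn_apply_of_not_mem σ T _ hq, xorOn_apply_of_not_mem σ T _ hq]

end CnotLayer

end SamplerRegs

end Regev2009

end Literature.Computability.Cryptography

end
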